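import Summits.BirchSwinnertonDyer.BirchSwinnertonDyer.Theorems.BiquadraticEisensteinDescentHeegnerTwistCouplingInSupplySylvesterTwistPhiHatValuations
import Summits.BirchSwinnertonDyer.BirchSwinnertonDyer.Theorems.BiquadraticEisensteinDescentHeegnerTwistCouplingInSupplySylvesterTwistCubeUnits
import HarnessLib

set_option linter.dupNamespace false -- `Summit.BirchSwinnertonDyer.BirchSwinnertonDyer.Theorems.…` (summit = sub, D-0017)
set_option autoImplicit false

/-!
# Crux `HeegnerTwistCouplingInSupply` (stmt-BirchSwinnertonDyer-21381) — programme «TWISTED 3-ISOGENY DESCENT», file P6c₂: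
# the SHARP `φ̂`-BOX over `K = ℚ(√−2)` for the Sylvester twist `y² = x³ − 2p²` under the certificate `9 ∤ a` (`p = a² + 2b²`)

Route `BiquadraticEisensteinDescent` (cell `pub/bsd-wall`, width seat `bsd-wall-cm-bed-w4` g32; `--supports` 21381, helper). Assembly of
files P6a (valuations), P6b (`3`-adic cube) and P6c₁ (places of prime elements, class number one): for a quadratic number field
`K ∋ θ`, `θ² = −2`, with non-trivial automorphism `c`, a prime `p ≡ 8 (mod 9)` written `p = a² + 2b²`, and the `μ₃`-kernel Mordell datum
`E' = mordellCurve(−3c'²)`, `c' = 3pθ`: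

★★ `torsorClass_eq_zero_of_mem_sha_of_norm_cube` — if `9 ∤ a`, EVERY class `[C_u] ∈ Ш(E'/K)` with `u · c(u)` a non-zero `c`-fixed cube
VANISHES (the sharp box to feed `Literature…TwistedKummer.eq_zero_of_mem_sha_of_galH1Map_eq_zero_mordell`).

Proof. `π = a + bθ` is prime (norm `p`), `𝔭 = (π)`, `c • 𝔭 = (π̄) = 𝔭̄ ≠ 𝔭` (`gcd(2a, p) = 1`). With `A = log v_𝔭(u)` the element
`u' = u·(π/π̄)^A` has ALL valuations divisible by `3` (P6a off `p`; at `𝔭` by construction; at `𝔭̄` by the norm relation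
`v_𝔭(u) + v_𝔭̄(u) ≡ 0`), so `u' = ε z³`, `ε ∈ 𝓞_Kˣ = {±1}` (`𝓞 K ≅ ℤ[√−2]` is principal:
`exists_unit_mul_cube_of_forall_dvd_valuation`, by induction on the norm), i.e. `u'` is a cube. If `3 ∣ A`, `u` is a cube and `[C_u] = 0`. If `3 ∤ A`:
`u` (P6a/P6b) and `u'` are cubes in `K_𝔮`, `𝔮 = (1 + θ) ∋ 3`, hence so is `π/π̄`; in `K_𝔮 ≅ ℚ₃` (`θ ↦ s`, `s² = −2`) the `3`-adic
unit `(a + bs)/(a − bs)` is a cube, so `≡ ±1 (mod 9)`, forcing `a ≡ 0` or `b ≡ 0 (mod 9)`; `b ≡ 0` contradicts `a² + 2b² ≡ 8`, and `9 ∤ a` is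
the certificate (h2). CONTRADICTION.

HONEST FRAMING: the `φ̂`-half of the descent for ONE CM family, under the decidable certificate (h2) `9 ∤ a`; the `φ`-half (over `ℚ(√6)`,
certificate (h1)), the assembly to `rank = 0 ∧ Ш[3] = 0`, `hDescU` itself, the crux (residual C⁺) and BSD are untouched. THEOREMS ONLY
(no `def`, no named fact, no sorry). Supports stmt-BirchSwinnertonDyer-21381.
[cite: CohenPazuki2009, Proposition 2.2 and §4] [cite: SilvermanAEC2009, Thm. X.4.2 (a), Prop. X.4.9] [cite: Marcus2018, Ch. 5 Exercise 9 (m = −2)]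
-/

noncomputable section

open scoped Classical WithZero Pointwise

namespace Summit.BirchSwinnertonDyer.BirchSwinnertonDyer.Theorems.SylvesterTwistDescent

open Literature.NumberTheory.EllipticCurves Literature.NumberTheory.EllipticCurves.MordellDescent
open Literature.NumberTheory.NumberFields IsDedekindDomain IsDedekindDomain.HeightOneSpectrum NumberField
open Literature.NumberTheory.Automorphic Literature.NumberTheory.QuadraticFields
open WithZero (log exp)
open Summit.BirchSwinnertonDyer.BirchSwinnertonDyer.Theorems.UniversalToricDescentTwinDecLocusCubeTest (zmod9_unit_cube)

variable {K : Type} [Field K] [NumberField K] {θ : K} (hK : SqrtNegTwo.FieldData θ) (c : K ≃ₐ[ℚ] K) (hc : c ≠ 1)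
  {p : ℕ} (hp : p.Prime) (hp9 : p % 9 = 8) {a b : ℤ} (hab : a ^ 2 + 2 * b ^ 2 = p)

/-! ## §2 The sharp box -/

include hK hc hp hp9 hab in
/-- ★★ **THE SHARP `φ̂`-BOX.** For a quadratic number field `K ∋ θ`, `θ² = −2` (`hK`), its non-trivial automorphism `c`, a prime
`p ≡ 8 (mod 9)` with `p = a² + 2b²` and `9 ∤ a`, and the `μ₃`-kernel Mordell datum `E' = mordellCurve(−3c'²)`, `c' = 3pθ`: every class
`[C_u] ∈ Ш(E'/K)` whose parameter has CUBE NORM (`u · c u = r³`, `c r = r`, `r ≠ 0`) vanishes.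
[cite: CohenPazuki2009, Proposition 2.2 and §4] [cite: SilvermanAEC2009, Thm. X.4.2 (a), Prop. X.4.9] -/
theorem torsorClass_eq_zero_of_mem_sha_of_norm_cube (h9 : ¬ (9 : ℤ) ∣ a) (hc' : (3 * p * θ : K) ≠ 0) {D : K}
    (hD : D = -3 * (3 * p * θ) ^ 2) {u : K} (hu : u ≠ 0) (hnorm : ∃ r : K, c r = r ∧ r ≠ 0 ∧ u * c u = r ^ 3)
    (hsha : torsorClass hc' hD hu ∈ (mordellCurve D).sha) : torsorClass hc' hD hu = 0 := by
  have hK2 := hK.finrank_eq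
  have hθ := hK.sq_eq
  have hcθ : c θ = -θ := hK.algEquiv_theta hc
  have hp2 : 2 < p := by have := hp.two_le; omega
  -- ### the primes `π = a + bθ`, `π̄ = a − bθ` of `𝓞 K`
  obtain ⟨π, hπ⟩ : ∃ π : 𝓞 K, π = hK.ringEquiv ⟨a, b⟩ := ⟨_, rfl⟩
  obtain ⟨πb, hπb⟩ : ∃ πb : 𝓞 K, πb = hK.ringEquiv ⟨a, -b⟩ := ⟨_, rfl⟩
  have hπpr : Prime π := by
    rw [hπ]; exact (MulEquiv.prime_iff hK.ringEquiv).mpr (SqrtNegTwoPrimary.prime_of_norm_eq_prime hp (by rw [norm_mk, hab]))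
  have hπbpr : Prime πb := by
    rw [hπb]
    exact (MulEquiv.prime_iff hK.ringEquiv).mpr (SqrtNegTwoPrimary.prime_of_norm_eq_prime hp (by rw [norm_mk, ← hab]; ring))
  have hπK : (π : K) = a + b * θ := by rw [hπ, hK.coe_ringEquiv]
  have hπbK : (πb : K) = a - b * θ := by rw [hπb, hK.coe_ringEquiv]; push_cast; ring
  have habK : (a : K) ^ 2 + 2 * (b : K) ^ 2 = (p : K) := by exact_mod_cast congrArg (Int.cast : ℤ → K) hab
  have hππb : (π : K) * (πb : K) = p := by rw [hπK, hπbK]; linear_combination habK - (b : K) ^ 2 * hθ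
  have hπ0 : (π : K) ≠ 0 := RingOfIntegers.coe_ne_zero_iff.mpr hπpr.ne_zero
  have hπb0 : (πb : K) ≠ 0 := RingOfIntegers.coe_ne_zero_iff.mpr hπbpr.ne_zero
  have hcπ : c • π = πb := by rw [hπ, hK.smul_ringEquiv hc, hπb, Zsqrtd.star_mk]
  -- ### the places `𝔭 = (π)`, `𝔭̄ = (π̄) = c • 𝔭`, `𝔭̄ ≠ 𝔭`
  obtain ⟨𝔭, h𝔭⟩ := exists_place_of_prime (K := K) hπpr
  obtain ⟨𝔭b, h𝔭b⟩ := exists_place_of_prime (K := K) hπbpr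
  have hc𝔭 : c • 𝔭 = 𝔭b := by
    apply HeightOneSpectrum.ext
    rw [HeightOneSpectrum.smul_asIdeal, h𝔭, h𝔭b, Ideal.pointwise_smul_def, Ideal.map_span, Set.image_singleton,
      MulSemiringAction.toRingHom_apply, hcπ]
  have hpZ : Prime (p : ℤ) := Nat.prime_iff_prime_int.mp hp
  have hpa : ¬ (p : ℤ) ∣ a := by
    rintro ⟨k, hk⟩
    rcases eq_or_ne k 0 with rfl | hk0
    · rw [mul_zero] at hk
      rw [hk] at hab
      have h2p : (2 : ℤ) ∣ (p : ℤ) := ⟨b ^ 2, by linarith⟩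
      have h2p' : 2 ∣ p := by exact_mod_cast h2p
      rcases hp.eq_one_or_self_of_dvd 2 h2p' with h | h <;> omega
    · have h1 : 1 ≤ k ^ 2 := by nlinarith [Int.one_le_abs hk0, sq_abs k]
      have hpp : (p : ℤ) ^ 2 ≤ a ^ 2 := by
        rw [hk, mul_pow]; nlinarith [mul_le_mul_of_nonneg_left h1 (sq_nonneg (p : ℤ))]
      have hp3 : (3 : ℤ) ≤ p := by exact_mod_cast hp2
      nlinarith [sq_nonneg b]
  have hcop : IsCoprime (2 * a) (p : ℤ) := by
    rw [isCoprime_comm, Prime.coprime_iff_not_dvd hpZ]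
    intro hdvd
    rcases hpZ.dvd_or_dvd hdvd with h2 | ha
    · have := Int.le_of_dvd two_pos h2
      have : p ≤ 2 := by exact_mod_cast this
      omega
    · exact hpa ha
  have hne : 𝔭b ≠ 𝔭 := by
    intro heq
    have hπ_mem : π ∈ 𝔭.asIdeal := by rw [h𝔭]; exact Ideal.mem_span_singleton_self π
    have hπb_mem : πb ∈ 𝔭.asIdeal := by rw [← heq, h𝔭b]; exact Ideal.mem_span_singleton_self πb
    have h2a : ((2 * a : ℤ) : 𝓞 K) ∈ 𝔭.asIdeal := by
      have e : ((2 * a : ℤ) : 𝓞 K) = π + πb := by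
        apply RingOfIntegers.ext
        change (((2 * a : ℤ) : 𝓞 K) : K) = (π : K) + (πb : K)
        rw [RingOfIntegers.coe_eq_algebraMap ((2 * a : ℤ) : 𝓞 K), map_intCast, hπK, hπbK]; push_cast; ring
      rw [e]; exact add_mem hπ_mem hπb_mem
    have hpm : ((p : ℤ) : 𝓞 K) ∈ 𝔭.asIdeal := by
      have e : ((p : ℤ) : 𝓞 K) = π * πb := by
        apply RingOfIntegers.ext
        change (((p : ℤ) : 𝓞 K) : K) = (π : K) * (πb : K)
        rw [RingOfIntegers.coe_eq_algebraMap ((p : ℤ) : 𝓞 K), map_intCast, Int.cast_natCast, hππb]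
      rw [e]; exact Ideal.mul_mem_right _ _ hπ_mem
    obtain ⟨m, n, hmn⟩ := hcop
    have h1 : (1 : 𝓞 K) ∈ 𝔭.asIdeal := by
      have := add_mem (Ideal.mul_mem_left _ ((m : ℤ) : 𝓞 K) h2a) (Ideal.mul_mem_left _ ((n : ℤ) : 𝓞 K) hpm)
      rwa [← Int.cast_mul, ← Int.cast_mul, ← Int.cast_add, hmn, Int.cast_one] at this
    exact 𝔭.isPrime.ne_top ((Ideal.eq_top_iff_one _).mpr h1)
  -- ### valuations of `π`, `π̄`
  have vπ𝔭 : 𝔭.valuation K (π : K) = exp (-1 : ℤ) := valuation_self_of_span hπpr h𝔭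
  have vπb𝔭b : 𝔭b.valuation K (πb : K) = exp (-1 : ℤ) := valuation_self_of_span hπbpr h𝔭b
  have vπ𝔭b : 𝔭b.valuation K (π : K) = 1 := valuation_eq_one_of_ne hπpr h𝔭 hne
  have vπb𝔭 : 𝔭.valuation K (πb : K) = 1 := valuation_eq_one_of_ne hπbpr h𝔭b (Ne.symm hne)
  -- ### the corrected element `u' = u · g^A`, `g = π/π̄`, `A = log v_𝔭(u)`
  obtain ⟨A, hA⟩ : ∃ A : ℤ, A = log (𝔭.valuation K u) := ⟨_, rfl⟩
  obtain ⟨g, hg⟩ : ∃ g : K, g = (π : K) / (πb : K) := ⟨_, rfl⟩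
  have hg0 : g ≠ 0 := by rw [hg]; exact div_ne_zero hπ0 hπb0
  obtain ⟨u', hu'⟩ : ∃ u' : K, u' = u * g ^ A := ⟨_, rfl⟩
  have hu'0 : u' ≠ 0 := by rw [hu']; exact mul_ne_zero hu (zpow_ne_zero _ hg0)
  have hlog_u' : ∀ w : HeightOneSpectrum (𝓞 K),
      log (w.valuation K u') = log (w.valuation K u) + A * (log (w.valuation K (π : K)) - log (w.valuation K (πb : K))) := by
    intro w
    have h1 : w.valuation K u ≠ 0 := (Valuation.ne_zero_iff _).mpr hu
    have h2 : w.valuation K (π : K) ≠ 0 := (Valuation.ne_zero_iff _).mpr hπ0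
    have h3 : w.valuation K (πb : K) ≠ 0 := (Valuation.ne_zero_iff _).mpr hπb0
    rw [hu', map_mul, map_zpow₀, hg, map_div₀, WithZero.log_mul h1 (zpow_ne_zero _ (div_ne_zero h2 h3)), WithZero.log_zpow,
      WithZero.log_div h2 h3, zsmul_eq_mul, Int.cast_id]
  -- ### all valuations of `u'` are divisible by `3`
  have hall : ∀ w : HeightOneSpectrum (𝓞 K), (3 : ℤ) ∣ log (w.valuation K u') := by
    intro w
    rw [hlog_u' w]
    by_cases hw𝔭 : w = 𝔭
    · rw [hw𝔭, vπ𝔭, vπb𝔭, WithZero.log_exp, WithZero.log_one, ← hA]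
      exact ⟨0, by ring⟩
    by_cases hw𝔭b : w = 𝔭b
    · rw [hw𝔭b, vπ𝔭b, vπb𝔭b, WithZero.log_exp, WithZero.log_one]
      have hsum := three_dvd_log_add_log_smul hK2 c hu hnorm 𝔭
      rw [hc𝔭, ← hA] at hsum
      obtain ⟨k, hk⟩ := hsum
      exact ⟨k, by linear_combination hk⟩
    -- `w ∤ p`: `w(π) = w(π̄) = 1`
    rw [valuation_eq_one_of_ne hπpr h𝔭 hw𝔭, valuation_eq_one_of_ne hπbpr h𝔭b hw𝔭b, WithZero.log_one, sub_self, mul_zero,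
      add_zero]
    by_cases h2 : ((2 : ℕ) : 𝓞 K) ∈ w.asIdeal
    · exact three_dvd_log_valuation_of_two_mem hK2 hK c hu hnorm w h2
    by_cases h3 : ((3 : ℕ) : 𝓞 K) ∈ w.asIdeal
    · exact three_dvd_log_valuation_of_three_mem hK2 hθ c hc' hD hu hsha hcθ hp9 w h3
    have hpw : ((p : ℕ) : 𝓞 K) ∉ w.asIdeal := by
      intro hmem
      have e : ((p : ℕ) : 𝓞 K) = π * πb := by
        apply RingOfIntegers.ext
        change (((p : ℕ) : 𝓞 K) : K) = (π : K) * (πb : K)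
        rw [coe_natCast_ringOfIntegers, hππb]
      rw [e] at hmem
      rcases w.isPrime.mem_or_mem hmem with h | h
      · exact hw𝔭 (eq_of_mem_of_span hπpr h𝔭 h)
      · exact hw𝔭b (eq_of_mem_of_span hπbpr h𝔭b h)
    exact three_dvd_log_valuation_of_good hθ hc' hD hu hsha w h2 h3 hpw
  -- ### class number one and units `±1`: `u'` is a cube
  obtain ⟨z', hz'0, hz'⟩ : ∃ z' : K, z' ≠ 0 ∧ u' = z' ^ 3 := by
    haveI : IsPrincipalIdealRing (𝓞 K) := SqrtNegTwoIntegers.isPrincipalIdealRing_ringOfIntegers hK2 hθ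
    obtain ⟨ε, z, hεz⟩ := exists_unit_mul_cube_of_forall_dvd_valuation (K := K) hu'0 hall
    have hz0 : z ≠ 0 := by
      rintro rfl
      rw [zero_pow three_ne_zero, mul_zero] at hεz
      exact hu'0 hεz
    -- `ε = ±1`
    have hε : (ε : 𝓞 K) = 1 ∨ (ε : 𝓞 K) = -1 := by
      have hεu : IsUnit (hK.ringEquiv.symm (ε : 𝓞 K)) := (Units.isUnit ε).map hK.ringEquiv.symm
      rcases SqrtNegTwoPrimary.eq_of_isUnit hεu with h | h
      · left; apply hK.ringEquiv.symm.injective; rw [h, map_one]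
      · right; apply hK.ringEquiv.symm.injective; rw [h, map_neg, map_one]
    rcases hε with h | h
    · exact ⟨z, hz0, by rw [hεz, h, map_one, one_mul]⟩
    · exact ⟨-z, neg_ne_zero.mpr hz0, by rw [hεz, h, map_neg, map_one]; ring⟩
  by_cases hA3 : (3 : ℤ) ∣ A
  · -- ### Case `3 ∣ A`: `u = u'·g^{−A}` is a cube, so `[C_u] = 0`
    obtain ⟨m, hm⟩ := hA3
    have hucube : u = (z' * g ^ (-m)) ^ 3 := by
      have e1 : u = u' * g ^ (-A) := by rw [hu', mul_assoc, ← zpow_add₀ hg0, add_neg_cancel, zpow_zero, mul_one]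
      rw [e1, hz', hm, mul_pow, ← zpow_natCast (g ^ (-m)) 3, ← zpow_mul]
      congr 2; push_cast; ring
    exact MordellDescent.torsorClass_of_eq_cube hc' hD hu _ hucube
  · -- ### Case `3 ∤ A`: contradiction at `𝔮 = (1 + θ) ∋ 3` via `K_𝔮 ≅ ℚ₃`
    exfalso
    obtain ⟨ω₀, hω₀⟩ : ∃ ω₀ : 𝓞 K, ω₀ = hK.ringEquiv ⟨1, 1⟩ := ⟨_, rfl⟩
    have hωpr : Prime ω₀ := by
      rw [hω₀]
      exact (MulEquiv.prime_iff hK.ringEquiv).mpr (SqrtNegTwoPrimary.prime_of_norm_eq_prime Nat.prime_three (by rw [norm_mk]; norm_num))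
    obtain ⟨𝔮, h𝔮⟩ := exists_place_of_prime (K := K) hωpr
    have h3𝔮 : ((3 : ℕ) : 𝓞 K) ∈ 𝔮.asIdeal := by
      have e : ((3 : ℕ) : 𝓞 K) = ω₀ * hK.ringEquiv ⟨1, -1⟩ := by
        apply RingOfIntegers.ext
        change (((3 : ℕ) : 𝓞 K) : K) = (ω₀ : K) * ((hK.ringEquiv ⟨1, -1⟩ : 𝓞 K) : K)
        rw [coe_natCast_ringOfIntegers, hω₀, hK.coe_ringEquiv, hK.coe_ringEquiv]
        push_cast; linear_combination hθ
      rw [e, h𝔮]; exact Ideal.mul_mem_right _ _ (Ideal.mem_span_singleton_self _)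
    -- `u`, `u'` are cubes in `K_𝔮`; hence so are `g ^ A` and (Bézout) `g`
    obtain ⟨z₁, hz₁0, hz₁⟩ := exists_eq_cube_adicCompletion_of_three_mem hK2 hθ c hc' hD hu hsha hcθ hp9 𝔮 h3𝔮
    have hιu0 : algebraMap K (𝔮.adicCompletion K) u ≠ 0 := (map_ne_zero _).mpr hu
    have hgA : algebraMap K (𝔮.adicCompletion K) g ^ A = (algebraMap K (𝔮.adicCompletion K) z' / z₁) ^ 3 := by
      rw [div_pow, ← map_pow, ← hz', ← hz₁, hu', map_mul, map_zpow₀, mul_div_cancel_left₀ _ hιu0]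
    obtain ⟨t, ht⟩ := exists_eq_cube_of_zpow_eq_cube ((map_ne_zero _).mpr hg0) hA3 hgA
    -- ### transport to `ℚ₃`
    haveI : Fact (Nat.Prime 3) := ⟨Nat.prime_three⟩
    haveI := liesOver_ratPlace_of_natCast_mem K 𝔮 h3𝔮
    have hne𝔮 := smul_ne_of_three_mem hθ c hcθ 𝔮 h3𝔮
    have h3𝔮' : ((3 : ℕ) : 𝓞 K) ∈ (c • 𝔮).asIdeal := by
      rw [HeightOneSpectrum.smul_asIdeal]
      have e : c • ((3 : ℕ) : 𝓞 K) = ((3 : ℕ) : 𝓞 K) := by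
        apply RingOfIntegers.ext
        rw [RingOfIntegers.coe_algEquiv_smul, coe_natCast_ringOfIntegers, map_natCast]
      have : c • ((3 : ℕ) : 𝓞 K) ∈ c • 𝔮.asIdeal := Ideal.smul_mem_pointwise_smul_iff.mpr h3𝔮
      rwa [e] at this
    obtain ⟨he, hf⟩ := ramificationIdx_eq_one_and_inertiaDeg_eq_one_of_natCast_mem_of_ne K hK2 h3𝔮 h3𝔮' hne𝔮
    obtain ⟨e, -⟩ : ∃ e : 𝔮.adicCompletion K ≃+* ℚ_[3], True := ⟨padicEquivOfDegreeOne K 3 𝔮 he hf, trivial⟩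
    obtain ⟨ψ, hψ⟩ : ∃ ψ : K →+* ℚ_[3], ψ = e.toRingHom.comp (algebraMap K (𝔮.adicCompletion K)) := ⟨_, rfl⟩
    have hψ_apply : ∀ x : K, ψ x = e (algebraMap K (𝔮.adicCompletion K) x) := fun x => by rw [hψ]; rfl
    -- `s = ψ θ`: `s² = −2`, `s ∈ ℤ₃`
    obtain ⟨s, hs⟩ : ∃ s : ℚ_[3], s = ψ θ := ⟨_, rfl⟩
    have hs2 : s ^ 2 = -2 := by rw [hs, ← map_pow, hθ, map_neg, map_ofNat]
    have hs1 : ‖s‖ = 1 := by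
      have h2 : ‖s‖ ^ 2 = ‖(2 : ℚ_[3])‖ := by rw [← norm_pow, hs2, norm_neg]
      have h2' : ‖(2 : ℚ_[3])‖ = 1 := by
        rw [show (2 : ℚ_[3]) = ((2 : ℕ) : ℚ_[3]) by norm_cast, Padic.norm_eq_zpow_neg_valuation (by norm_num),
          Padic.valuation_natCast]
        norm_num [padicValNat.eq_zero_of_not_dvd]
      rw [h2'] at h2
      nlinarith [norm_nonneg s, h2]
    set sZ : ℤ_[3] := ⟨s, hs1.le⟩ with hsZ
    have hsZc : (sZ : ℚ_[3]) = s := rfl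
    have hsZ2 : sZ ^ 2 = -2 := by
      apply Subtype.coe_injective
      change s ^ 2 = ((-2 : ℤ_[3]) : ℚ_[3])
      rw [hs2]; push_cast; rw [padicInt_coe_ofNat]
    -- `α = a + b s`, `β = a − b s` in `ℤ₃`: `α β = p`, both units
    obtain ⟨α, hα⟩ : ∃ α : ℤ_[3], α = (a : ℤ_[3]) + (b : ℤ_[3]) * sZ := ⟨_, rfl⟩
    obtain ⟨β, hβ⟩ : ∃ β : ℤ_[3], β = (a : ℤ_[3]) - (b : ℤ_[3]) * sZ := ⟨_, rfl⟩
    have habZ : (a : ℤ_[3]) ^ 2 + 2 * (b : ℤ_[3]) ^ 2 = (p : ℤ_[3]) := by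
      exact_mod_cast congrArg (Int.cast : ℤ → ℤ_[3]) hab
    have hαβ : α * β = (p : ℤ_[3]) := by rw [hα, hβ]; linear_combination habZ - (b : ℤ_[3]) ^ 2 * hsZ2
    have hp3 : ¬ 3 ∣ p := by omega
    have hpunit : ‖(p : ℤ_[3])‖ = 1 := by
      rw [show (p : ℤ_[3]) = ((p : ℤ) : ℤ_[3]) by norm_cast]
      have hle := PadicInt.norm_le_one ((p : ℤ) : ℤ_[3])
      have hnlt : ¬ ‖((p : ℤ) : ℤ_[3])‖ < 1 := by
        rw [PadicInt.norm_int_lt_one_iff_dvd]; exact_mod_cast hp3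
      exact le_antisymm hle (not_lt.mp hnlt)
    have hnorm1 : ‖α‖ * ‖β‖ = 1 := by rw [← norm_mul, hαβ, hpunit]
    have hα1 := PadicInt.norm_le_one α
    have hβ1 := PadicInt.norm_le_one β
    have hαu : ‖α‖ = 1 := by nlinarith [norm_nonneg α, norm_nonneg β]
    have hβu : ‖β‖ = 1 := by nlinarith [norm_nonneg α, norm_nonneg β]
    have hβ0 : (β : ℚ_[3]) ≠ 0 := by
      rw [Ne, PadicInt.coe_eq_zero]; rintro rfl; rw [norm_zero] at hβu; exact zero_ne_one hβu
    -- `ψ g = α/β` is the cube `(e t)³`, `e t` a `3`-adic unit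
    have hψg : ψ g = (α : ℚ_[3]) / (β : ℚ_[3]) := by
      rw [hg, map_div₀, hπK, hπbK]
      simp only [map_add, map_sub, map_mul, map_intCast, ← hs]
      rw [hα, hβ]
      push_cast
      rw [hsZc]
    have hq : (α : ℚ_[3]) / β = (e t) ^ 3 := by rw [← hψg, hψ_apply, ht, map_pow]
    have hw1 : ‖e t‖ = 1 := by
      have h := congrArg (‖·‖) hq
      simp only [norm_div, norm_pow, PadicInt.padic_norm_e_of_padicInt, hαu, hβu, div_one] at h
      exact (pow_eq_one_iff_of_nonneg (norm_nonneg _) three_ne_zero).mp h.symm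
    set wZ : ℤ_[3] := ⟨e t, hw1.le⟩ with hwZ
    have hwZc : (wZ : ℚ_[3]) = e t := rfl
    have hαβw : α = β * wZ ^ 3 := by
      apply Subtype.coe_injective
      change (α : ℚ_[3]) = ((β * wZ ^ 3 : ℤ_[3]) : ℚ_[3])
      push_cast
      rw [hwZc, ← hq, mul_div_cancel₀ _ hβ0]
    -- ### reduce mod `9`
    have hw9 : PadicInt.toZModPow 2 wZ ^ 3 = 1 ∨ PadicInt.toZModPow 2 wZ ^ 3 = -1 := by
      obtain ⟨wi, hwi⟩ := (PadicInt.isUnit_iff.mpr (show ‖wZ‖ = 1 from hw1)).exists_right_inv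
      have := congrArg (PadicInt.toZModPow 2) hwi
      rw [map_mul, map_one] at this
      exact zmod9_unit_cube _ _ this
    have hs9 : PadicInt.toZModPow 2 sZ ^ 2 = -2 := by rw [← map_pow, hsZ2, map_neg, map_ofNat]
    have hp9' : ((p : ℕ) : ZMod (3 ^ 2)) = 8 := by
      have : ((p : ℕ) : ZMod (3 ^ 2)) = ((8 : ℕ) : ZMod (3 ^ 2)) :=
        (ZMod.natCast_eq_natCast_iff' p 8 (3 ^ 2)).mpr (by norm_num [hp9])
      rw [this, Nat.cast_ofNat]
    have hab9 : (a : ZMod (3 ^ 2)) ^ 2 + 2 * (b : ZMod (3 ^ 2)) ^ 2 = 8 := by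
      have h := congrArg (Int.cast : ℤ → ZMod (3 ^ 2)) hab
      push_cast at h
      rw [h, hp9']
    have h9a : (a : ZMod (3 ^ 2)) ≠ 0 := by
      intro h0
      have h0' := (ZMod.intCast_zmod_eq_zero_iff_dvd a (3 ^ 2)).mp h0
      norm_num at h0'
      exact h9 h0'
    have key := congrArg (PadicInt.toZModPow 2) hαβw
    rw [hα, hβ] at key
    simp only [map_add, map_sub, map_mul, map_pow, map_intCast] at key
    -- the finite check in `ℤ/9`: `ā + b̄s̄ = ±(ā − b̄s̄)`, `ā² + 2b̄² = 8`, `s̄² = −2` force `ā = 0`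
    have hfin : ∀ (x y S : ZMod (3 ^ 2)), x ^ 2 + 2 * y ^ 2 = 8 → S ^ 2 = -2 →
        (x + y * S = (x - y * S) ∨ x + y * S = -(x - y * S)) → x = 0 := by decide
    refine h9a (hfin _ _ _ hab9 hs9 ?_)
    rcases hw9 with h | h
    · left; rw [key, h, mul_one]
    · right; rw [key, h, mul_neg_one]

end Summit.BirchSwinnertonDyer.BirchSwinnertonDyer.Theorems.SylvesterTwistDescent

end
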